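import Literature.Barriers.RiemannHypothesis.JensenPolynomials
import Literature.Analysis.Complex.JensenCircles
import Literature.Analysis.Complex.GontcharoffEstimate
import Mathlib.Algebra.Order.Chebyshev
import HarnessLib

/-!
# Proof of Kim's theorem (Farmer 2022, §2) for real entire functions of order `< 2`

Sibling ("Proofs") file of `Literature/Barriers/RiemannHypothesis/JensenPolynomials.lean` (the other
sibling, `JensenPolynomialsProofs.lean`, discharges `GORZ2019_thm3_corollary`). This file discharges
the named fact `Literature.Barriers.RiemannHypothesis.Farmer2022_kimTheorem`
(`Farmer2022_kimTheorem_holds`):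

> "if `f` is an entire function of order less than 2, which is real on the real axis, and which
> has all zeros in a strip `|Im(z)| < A`, then for any fixed `R > 0`, if `n` is sufficiently large
> then `f^{(n)}` has only real zeros in `|z| < R`" (Farmer 2022, §2, quoting Kim 1996),

with the tree's guard that no derivative of `f` vanishes identically.

## The proof (Ki–Kim 2000, §2, adapted to the local statement)

Ki and Kim (Duke Math. J. 104 (2000), §2, Thm. 2.1 and Remark 2.2 (b)) prove the Pólya–Wiman
theorem by combining three ingredients, all PROVED in the tree:

1. **Jensen's theorem** (`Literature.Analysis.Complex.jensen_circle_iteratedDeriv_pos`,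
   `Literature/Analysis/Complex/JensenCircles.lean`): a zero `w` of `f^{(k+1)}` with `Im w > 0`
   lies in the Jensen disc of a zero `a` of `f^{(k)}` with `Im a > 0`:
   `(Re w − Re a)² + (Im w)² ≤ (Im a)²`. Iterating downwards from a non-real zero of `f^{(n)}`
   gives a *Jensen chain* `z₀, …, zₙ` (`exists_jensen_chain`), `f^{(k)}(z_k) = 0`, whose total
   variation is `≤ Im z₀ (1 + √n) ≤ Δ(1 + √n)` by Cauchy–Schwarz (Ki–Kim (2.5);
   `chain_variation_le`), `Δ` the half-width of the strip containing the zeros.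
2. **Gontcharoff's estimate** (Ki–Kim (2.3); `Literature.Analysis.Complex.gontcharoff_norm_le`):
   `|f(u)| ≤ M(f^{(n)}) Lⁿ/n!` with `L` = `|u − z₀|` + variation `≤ A + B√n`.
3. **Cauchy's estimate** for `f^{(n)}` on a disc of radius `s = e² L` (Ki–Kim Lemma 2.1): since
   `‖f‖ ≤ C e^{r^ρ}` with `ρ < 2`, `M(f^{(n)}) Lⁿ/n! ≤ C e^{(a + b√n)^ρ} e^{−2n} ≤ C' e^{−n}`.

If the conclusion failed for some `R`, there would be non-real zeros of `f^{(n)}` in `|z| < R` for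
arbitrarily large `n`, whence `|f(u)| ≤ C' e^{−n}` for arbitrarily large `n`, i.e. `f ≡ 0`,
contradicting the guard (`f = f^{(0)} ≢ 0`). For order `< 2` no compactness argument (Ki–Kim's
infinite chains) is needed: growth `(2, 0)` beats any variation `O(√n)`.

## References

* D. W. Farmer, *Jensen polynomials are not a plausible route to proving the Riemann hypothesis*,
  Adv. Math. 411 (2022), 108781, §2.
* Y.-O. Kim, *Critical points of real entire functions and a conjecture of Pólya*, Proc. AMS 124
  (1996), 819–830 (cited through Farmer 2022, §2; the order-`2` part of genus `1*` is not covered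
  here, nor needed for the tree's statement).
* H. Ki, Y.-O. Kim, *On the number of nonreal zeros of real entire functions and the Fourier–Pólya
  conjecture*, Duke Math. J. 104 (2000), 45–73, §2 (Jensen's theorem, Lemma 2.1, (2.3), (2.5),
  Thm. 2.1, Remark 2.2 (b)).
-/

noncomputable section

open Complex Filter Metric Set Topology
open scoped ComplexConjugate

namespace Literature.Barriers.RiemannHypothesis

open Literature.Analysis.Complex

/-! ## Normalisation of the growth hypothesis -/

/-- From `IsEntireOfOrderLt 2 f` (`‖f‖ ≤ C e^{‖z‖^ρ}`, `ρ < 2`, possibly `ρ < 0`) to a bound with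
`0 ≤ ρ < 2` (replace `ρ` by `max ρ 0` and enlarge `C` by the maximum of `‖f‖` on the unit disc).
[folklore] -/
theorem exists_growth_nonneg {f : ℂ → ℂ} (hf : Literature.Analysis.Complex.IsEntireOfOrderLt 2 f) :
    ∃ ρ C : ℝ, 0 ≤ ρ ∧ ρ < 2 ∧ ∀ z, ‖f z‖ ≤ C * Real.exp (‖z‖ ^ ρ) := by
  obtain ⟨hd, ρ, C, hρ, hgr⟩ := hf
  obtain ⟨M₀, hM₀⟩ := (isCompact_closedBall (0 : ℂ) 1).exists_bound_of_continuousOn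
    hd.continuous.continuousOn
  refine ⟨max ρ 0, max |C| M₀, le_max_right _ _, max_lt hρ two_pos, fun z ↦ ?_⟩
  by_cases hz : ‖z‖ ≤ 1
  · calc ‖f z‖ ≤ M₀ := hM₀ z (mem_closedBall_zero_iff.mpr hz)
      _ ≤ M₀ * Real.exp (‖z‖ ^ max ρ 0) := by
          have hM : 0 ≤ M₀ := (norm_nonneg _).trans (hM₀ 0 (by simp))
          have : 1 ≤ Real.exp (‖z‖ ^ max ρ 0) := Real.one_le_exp (by positivity)
          nlinarith
      _ ≤ max |C| M₀ * Real.exp (‖z‖ ^ max ρ 0) := by gcongr; exact le_max_right _ _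
  · rw [not_le] at hz
    calc ‖f z‖ ≤ C * Real.exp (‖z‖ ^ ρ) := hgr z
      _ ≤ |C| * Real.exp (‖z‖ ^ ρ) := by gcongr; exact le_abs_self C
      _ ≤ |C| * Real.exp (‖z‖ ^ max ρ 0) := by
          apply mul_le_mul_of_nonneg_left _ (abs_nonneg C)
          exact Real.exp_le_exp.mpr (Real.rpow_le_rpow_of_exponent_le hz.le (le_max_left _ _))
      _ ≤ max |C| M₀ * Real.exp (‖z‖ ^ max ρ 0) := by gcongr; exact le_max_left _ _

/-! ## Jensen chains (Ki–Kim 2000, proof of Thm. 2.1) -/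

/-- **Backward Jensen chain.** Let `f` be real entire of order `< 2` with no derivative vanishing
identically, and let `w`, `Im w > 0`, be a zero of `f^{(n)}`. Then there are `z₀, …, zₙ = w` in
the upper half-plane with `f^{(k)}(z_k) = 0` and `z_{k+1}` in the Jensen disc of `z_k`:
`(Re z_{k+1} − Re z_k)² + (Im z_{k+1})² ≤ (Im z_k)²` (Jensen's theorem applied `n` times).
[cite: KiKim2000, §2 proof of Thm. 2.1] -/
theorem exists_jensen_chain {f : ℂ → ℂ} (hf : Differentiable ℂ f) {ρ C : ℝ} (hρ0 : 0 ≤ ρ)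
    (hρ : ρ < 2) (hgr : ∀ z, ‖f z‖ ≤ C * Real.exp (‖z‖ ^ ρ)) (hreal : ∀ x : ℝ, (f x).im = 0)
    (hnz : ∀ n : ℕ, iteratedDeriv n f ≠ 0) (n : ℕ) {w : ℂ} (hw : 0 < w.im)
    (hfw : iteratedDeriv n f w = 0) :
    ∃ z : ℕ → ℂ, z n = w ∧ (∀ k ≤ n, iteratedDeriv k f (z k) = 0) ∧ (∀ k ≤ n, 0 < (z k).im) ∧
      ∀ k < n, ((z (k + 1)).re - (z k).re) ^ 2 + (z (k + 1)).im ^ 2 ≤ (z k).im ^ 2 := by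
  induction n generalizing w with
  | zero =>
    refine ⟨fun _ ↦ w, rfl, fun k hk ↦ ?_, fun k _ ↦ hw, fun k hk ↦ absurd hk (Nat.not_lt_zero _)⟩
    rw [Nat.le_zero.1 hk]; exact hfw
  | succ n ih =>
    obtain ⟨a, ha, ha0, hdisc⟩ := jensen_circle_iteratedDeriv_pos hf hρ0 hρ hgr hreal hnz n hw hfw
    obtain ⟨z, hzn, hzero, hpos, hrel⟩ := ih ha0 ha
    refine ⟨fun k ↦ if k = n + 1 then w else z k, if_pos rfl, ?_, ?_, ?_⟩
    · intro k hk
      rcases Nat.lt_or_eq_of_le hk with hk' | rfl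
      · dsimp only; rw [if_neg hk'.ne]; exact hzero k (Nat.lt_succ_iff.1 hk')
      · dsimp only; rw [if_pos rfl]; exact hfw
    · intro k hk
      rcases Nat.lt_or_eq_of_le hk with hk' | rfl
      · dsimp only; rw [if_neg hk'.ne]; exact hpos k (Nat.lt_succ_iff.1 hk')
      · dsimp only; rw [if_pos rfl]; exact hw
    · intro k hk
      rcases Nat.lt_or_eq_of_le (Nat.lt_succ_iff.1 hk) with hk' | hk'
      · dsimp only
        rw [if_neg (by omega : k + 1 ≠ n + 1), if_neg (by omega : k ≠ n + 1)]
        exact hrel k hk'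
      · dsimp only
        rw [hk', if_pos rfl, if_neg (by omega : n ≠ n + 1), hzn]
        exact hdisc

/-- **Variation of a Jensen chain (Ki–Kim 2000, (2.5)).** If `Im z_k > 0` (`k ≤ n`) and
`(Re z_{k+1} − Re z_k)² + (Im z_{k+1})² ≤ (Im z_k)²` (`k < n`), then
`∑_{k<n} |z_k − z_{k+1}| ≤ (Im z₀ − Im zₙ) + √(n((Im z₀)² − (Im zₙ)²)) ≤ Im z₀ (1 + √n)`
(Cauchy–Schwarz). [cite: KiKim2000, §2 eq. (2.5)] -/
theorem chain_variation_le {z : ℕ → ℂ} {n : ℕ} (hpos : ∀ k ≤ n, 0 < (z k).im)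
    (hrel : ∀ k < n, ((z (k + 1)).re - (z k).re) ^ 2 + (z (k + 1)).im ^ 2 ≤ (z k).im ^ 2) :
    ∑ k ∈ Finset.range n, ‖z k - z (k + 1)‖ ≤ (z 0).im * (1 + Real.sqrt n) := by
  -- the imaginary parts decrease
  have him : ∀ k < n, (z (k + 1)).im ≤ (z k).im := fun k hk ↦ by
    have h := hrel k hk
    have h1 := hpos (k + 1) hk
    have h2 := hpos k hk.le
    nlinarith [sq_nonneg ((z (k + 1)).re - (z k).re)]
  set δ : ℕ → ℝ := fun k ↦ (z k).im ^ 2 - (z (k + 1)).im ^ 2 with hδ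
  have hδ0 : ∀ k < n, 0 ≤ δ k := fun k hk ↦ by
    have h := hrel k hk
    simp only [hδ]
    nlinarith [sq_nonneg ((z (k + 1)).re - (z k).re)]
  -- one step: `|z_k - z_{k+1}| ≤ √δ_k + (Im z_k - Im z_{k+1})`
  have hstep : ∀ k ∈ Finset.range n,
      ‖z k - z (k + 1)‖ ≤ Real.sqrt (δ k) + ((z k).im - (z (k + 1)).im) := by
    intro k hk
    rw [Finset.mem_range] at hk
    have hre : |(z k - z (k + 1)).re| ≤ Real.sqrt (δ k) := by
      apply Real.abs_le_sqrt
      rw [Complex.sub_re]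
      have h := hrel k hk
      simp only [hδ]
      nlinarith
    have himk : |(z k - z (k + 1)).im| = (z k).im - (z (k + 1)).im := by
      rw [Complex.sub_im, abs_of_nonneg (sub_nonneg.2 (him k hk))]
    calc ‖z k - z (k + 1)‖ ≤ |(z k - z (k + 1)).re| + |(z k - z (k + 1)).im| :=
          Complex.norm_le_abs_re_add_abs_im _
      _ ≤ Real.sqrt (δ k) + ((z k).im - (z (k + 1)).im) := by rw [himk]; exact add_le_add hre le_rfl
  -- sum up
  have hsum1 : ∑ k ∈ Finset.range n, ((z k).im - (z (k + 1)).im) = (z 0).im - (z n).im :=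
    Finset.sum_range_sub' (fun k ↦ (z k).im) n
  have hsum3 : ∑ k ∈ Finset.range n, δ k = (z 0).im ^ 2 - (z n).im ^ 2 :=
    Finset.sum_range_sub' (fun k ↦ (z k).im ^ 2) n
  have hCS : (∑ k ∈ Finset.range n, Real.sqrt (δ k)) ^ 2 ≤ n * ((z 0).im ^ 2 - (z n).im ^ 2) := by
    have h := sq_sum_le_card_mul_sum_sq (s := Finset.range n) (f := fun k ↦ Real.sqrt (δ k))
    rw [Finset.card_range] at h
    refine h.trans (le_of_eq ?_)
    rw [← hsum3]
    congr 1
    refine Finset.sum_congr rfl fun k hk ↦ ?_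
    exact Real.sq_sqrt (hδ0 k (Finset.mem_range.1 hk))
  have hsqrt : ∑ k ∈ Finset.range n, Real.sqrt (δ k) ≤ Real.sqrt n * (z 0).im := by
    have h0 : 0 ≤ ∑ k ∈ Finset.range n, Real.sqrt (δ k) :=
      Finset.sum_nonneg fun k _ ↦ Real.sqrt_nonneg _
    have hz0 : 0 ≤ (z 0).im := (hpos 0 (Nat.zero_le _)).le
    have h1 : (∑ k ∈ Finset.range n, Real.sqrt (δ k)) ^ 2 ≤ (Real.sqrt n * (z 0).im) ^ 2 := by
      calc (∑ k ∈ Finset.range n, Real.sqrt (δ k)) ^ 2 ≤ n * ((z 0).im ^ 2 - (z n).im ^ 2) := hCS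
        _ ≤ n * (z 0).im ^ 2 := by
            apply mul_le_mul_of_nonneg_left _ (Nat.cast_nonneg n)
            nlinarith [sq_nonneg (z n).im]
        _ = (Real.sqrt n * (z 0).im) ^ 2 := by
            rw [mul_pow, Real.sq_sqrt (Nat.cast_nonneg n)]
    exact (pow_le_pow_iff_left₀ h0 (by positivity) two_ne_zero).1 h1
  have hzn : 0 ≤ (z n).im := (hpos n le_rfl).le
  calc ∑ k ∈ Finset.range n, ‖z k - z (k + 1)‖
      ≤ ∑ k ∈ Finset.range n, (Real.sqrt (δ k) + ((z k).im - (z (k + 1)).im)) :=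
        Finset.sum_le_sum hstep
    _ = ∑ k ∈ Finset.range n, Real.sqrt (δ k) + ((z 0).im - (z n).im) := by
        rw [Finset.sum_add_distrib, hsum1]
    _ ≤ Real.sqrt n * (z 0).im + (z 0).im := by linarith
    _ = (z 0).im * (1 + Real.sqrt n) := by ring

/-! ## Cauchy's estimate under the growth bound (Ki–Kim 2000, Lemma 2.1) -/

/-- **Cauchy's estimate for `f^{(n)}` under `‖f‖ ≤ C e^{‖z‖^ρ}`:** for `‖u‖ ≤ r` and `s > 0`,
`‖f^{(n)}(u)‖ ≤ n! C e^{(r+s)^ρ}/sⁿ`. [cite: KiKim2000, §2 Lemma 2.1] -/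
theorem norm_iteratedDeriv_le_of_growth {f : ℂ → ℂ} (hf : Differentiable ℂ f) {ρ C : ℝ}
    (hρ0 : 0 ≤ ρ) (hgr : ∀ z, ‖f z‖ ≤ C * Real.exp (‖z‖ ^ ρ)) (n : ℕ) {r s : ℝ}
    (hs : 0 < s) {u : ℂ} (hu : ‖u‖ ≤ r) :
    ‖iteratedDeriv n f u‖ ≤ n.factorial * (C * Real.exp ((r + s) ^ ρ)) / s ^ n := by
  have hC := growthConst_nonneg hgr
  refine Complex.norm_iteratedDeriv_le_of_forall_mem_sphere_norm_le n hs hf.diffContOnCl ?_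
  intro v hv
  have hv' : ‖v‖ ≤ r + s := by
    have h1 : ‖v - u‖ = s := mem_sphere_iff_norm.1 hv
    calc ‖v‖ = ‖(v - u) + u‖ := by ring_nf
      _ ≤ ‖v - u‖ + ‖u‖ := norm_add_le _ _
      _ ≤ r + s := by rw [h1]; linarith
  exact (hgr v).trans (mul_le_mul_of_nonneg_left
    (Real.exp_le_exp.2 (Real.rpow_le_rpow (norm_nonneg _) hv' hρ0)) hC)

/-- For `0 ≤ ρ < 2` and `ε > 0`: `x^ρ ≤ ε x² + K` for all `x ≥ 0` (with `K = x₀^ρ`,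
`x₀ = ε^{−1/(2−ρ)}`). [folklore] -/
theorem exists_rpow_le_eps_mul_sq_add {ρ : ℝ} (hρ0 : 0 ≤ ρ) (hρ : ρ < 2) {ε : ℝ} (hε : 0 < ε) :
    ∃ K : ℝ, 0 ≤ K ∧ ∀ x : ℝ, 0 ≤ x → x ^ ρ ≤ ε * x ^ 2 + K := by
  set x₀ : ℝ := (1 / ε) ^ (1 / (2 - ρ)) with hx₀
  have hx₀pos : 0 < x₀ := Real.rpow_pos_of_pos (by positivity) _
  refine ⟨x₀ ^ ρ, Real.rpow_nonneg hx₀pos.le _, fun x hx ↦ ?_⟩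
  rcases le_or_gt x x₀ with h | h
  · calc x ^ ρ ≤ x₀ ^ ρ := Real.rpow_le_rpow hx h hρ0
      _ ≤ ε * x ^ 2 + x₀ ^ ρ := le_add_of_nonneg_left (by positivity)
  · have hxpos : 0 < x := hx₀pos.trans h
    have h1 : x ^ ρ = x ^ (2 : ℝ) * x ^ (ρ - 2) := by
      rw [← Real.rpow_add hxpos]; ring_nf
    have h2 : x ^ (ρ - 2) ≤ x₀ ^ (ρ - 2) := Real.rpow_le_rpow_of_nonpos hx₀pos h.le (by linarith)
    have h3 : x₀ ^ (ρ - 2) = ε := by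
      rw [hx₀, ← Real.rpow_mul (by positivity)]
      have : 1 / (2 - ρ) * (ρ - 2) = -1 := by
        have : (2 - ρ) ≠ 0 := by linarith
        field_simp; ring
      rw [this, Real.rpow_neg_one, one_div, inv_inv]
    calc x ^ ρ = x ^ (2 : ℝ) * x ^ (ρ - 2) := h1
      _ ≤ x ^ (2 : ℝ) * ε := by
          rw [h3] at h2
          exact mul_le_mul_of_nonneg_left h2 (by positivity)
      _ = ε * x ^ 2 := by rw [Real.rpow_two]; ring
      _ ≤ ε * x ^ 2 + x₀ ^ ρ := le_add_of_nonneg_right (by positivity)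

/-! ## Kim's theorem -/

/-- **The key estimate.** Let `f` be real entire with `‖f‖ ≤ C e^{‖z‖^ρ}` (`0 ≤ ρ < 2`), no
derivative vanishing identically, and all zeros of all derivatives in `|Im z| ≤ Δ` (`Δ ≥ 0`). Fix
`u ∈ ℂ` and `R > 0`. Then there is `K` such that for every `n ≥ 1` for which `f^{(n)}` has a zero
`w` with `|w| < R`, `Im w > 0`, one has `‖f(u)‖ ≤ C e^{K} e^{−n}`. (Jensen chain, Gontcharoff's
estimate on the disc `|z| ≤ |u| + L`, `L = |u| + R + 2Δ + 2Δ√n`, and Cauchy's estimate with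
radius `e² L`.) [cite: KiKim2000, §2 proof of Thm. 2.1] -/
theorem norm_le_exp_neg_of_nonreal_zero {f : ℂ → ℂ} (hf : Differentiable ℂ f) {ρ C : ℝ}
    (hρ0 : 0 ≤ ρ) (hρ : ρ < 2) (hgr : ∀ z, ‖f z‖ ≤ C * Real.exp (‖z‖ ^ ρ))
    (hreal : ∀ x : ℝ, (f x).im = 0) (hnz : ∀ n : ℕ, iteratedDeriv n f ≠ 0) {Δ : ℝ} (hΔ : 0 ≤ Δ)
    (hstrip : ∀ (k : ℕ) (z : ℂ), iteratedDeriv k f z = 0 → |z.im| ≤ Δ) (u : ℂ) {R : ℝ}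
    (hR : 0 < R) :
    ∃ K : ℝ, ∀ n : ℕ, 1 ≤ n → (∃ w : ℂ, ‖w‖ < R ∧ iteratedDeriv n f w = 0 ∧ 0 < w.im) →
      ‖f u‖ ≤ C * Real.exp K * Real.exp (-(n : ℝ)) := by
  have hC : 0 ≤ C := growthConst_nonneg hgr
  -- constants
  set A : ℝ := ‖u‖ + R + 2 * Δ with hA
  set B : ℝ := 2 * Δ with hB
  have hApos : 0 < A := by positivity
  have hB0 : 0 ≤ B := by positivity
  set a : ℝ := ‖u‖ + (1 + Real.exp 2) * A with ha
  set b : ℝ := (1 + Real.exp 2) * B with hb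
  have ha0 : 0 ≤ a := by positivity
  have hb0 : 0 ≤ b := by positivity
  obtain ⟨K, hK0, hK⟩ :=
    exists_rpow_le_eps_mul_sq_add hρ0 hρ (ε := 1 / (2 * b ^ 2 + 2)) (by positivity)
  refine ⟨K + a ^ 2, fun n hn ⟨w, hwR, hw0, hwim⟩ ↦ ?_⟩
  obtain ⟨z, hzn, hzero, hpos, hrel⟩ := exists_jensen_chain hf hρ0 hρ hgr hreal hnz n hwim hw0
  -- the variation of the chain
  set V : ℝ := ∑ k ∈ Finset.range n, ‖z k - z (k + 1)‖ with hV
  have hV0 : 0 ≤ V := Finset.sum_nonneg fun k _ ↦ norm_nonneg _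
  have hz0im : (z 0).im ≤ Δ :=
    (le_abs_self _).trans (hstrip 0 (z 0) (hzero 0 (Nat.zero_le _)))
  have hVle : V ≤ Δ * (1 + Real.sqrt n) :=
    (chain_variation_le hpos hrel).trans (mul_le_mul_of_nonneg_right hz0im (by positivity))
  set L : ℝ := A + B * Real.sqrt n with hL
  have hLpos : 0 < L := by positivity
  have hVL : R + 2 * V ≤ L - ‖u‖ := by
    rw [hL, hA, hB]; nlinarith [Real.sqrt_nonneg (n : ℝ)]
  -- all points of the chain are within `V` of `w = z n`
  have hzk : ∀ k ≤ n, ‖z k - z n‖ ≤ V := by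
    intro k hk
    have h := dist_le_Ico_sum_dist z hk
    rw [dist_eq_norm] at h
    refine h.trans ?_
    simp only [dist_eq_norm]
    refine Finset.sum_le_sum_of_subset_of_nonneg ?_ fun i _ _ ↦ norm_nonneg _
    rw [Finset.range_eq_Ico]
    exact Finset.Ico_subset_Ico_left (Nat.zero_le _)
  have hznorm : ∀ k ≤ n, ‖z k‖ ≤ R + V := by
    intro k hk
    calc ‖z k‖ = ‖(z k - z n) + z n‖ := by rw [sub_add_cancel]
      _ ≤ ‖z k - z n‖ + ‖z n‖ := norm_add_le _ _
      _ ≤ V + R := add_le_add (hzk k hk) (by rw [hzn]; exact hwR.le)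
      _ = R + V := add_comm _ _
  -- the convex set and memberships
  set Kset : Set ℂ := closedBall (0 : ℂ) (‖u‖ + L) with hKset
  have hKconv : Convex ℝ Kset := convex_closedBall _ _
  have hmemz : ∀ k ≤ n, z k ∈ Kset := fun k hk ↦ by
    rw [hKset, mem_closedBall_zero_iff]
    have := hznorm k hk
    linarith [norm_nonneg u]
  have hmemu : u ∈ Kset := by
    rw [hKset, mem_closedBall_zero_iff]; linarith
  -- write `n = j + 1`
  obtain ⟨j, rfl⟩ : ∃ j, n = j + 1 := ⟨n - 1, by omega⟩
  -- Cauchy's estimate on `Kset` with radius `s = e² L`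
  set s : ℝ := Real.exp 2 * L with hs
  have hspos : 0 < s := by positivity
  have hM : ∀ v ∈ Kset, ‖iteratedDeriv (j + 1) f v‖ ≤
      (j + 1).factorial * (C * Real.exp ((‖u‖ + L + s) ^ ρ)) / s ^ (j + 1) := fun v hv ↦
    norm_iteratedDeriv_le_of_growth hf hρ0 hgr (j + 1) hspos
      (by rw [hKset, mem_closedBall_zero_iff] at hv; exact hv)
  -- Gontcharoff
  have hG := gontcharoff_norm_le hKconv j hf z (fun k hk ↦ hmemz k (by omega))
    (fun k hk ↦ hzero k (by omega)) hM hmemu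
  -- the variation entering Gontcharoff's estimate is at most `L`
  have hvar : ‖u - z 0‖ + ∑ k ∈ Finset.range j, ‖z k - z (k + 1)‖ ≤ L := by
    have h1 : ∑ k ∈ Finset.range j, ‖z k - z (k + 1)‖ ≤ V := by
      rw [hV]
      exact Finset.sum_le_sum_of_subset_of_nonneg (Finset.range_subset_range.2 (Nat.le_succ j))
        fun i _ _ ↦ norm_nonneg _
    have h2 : ‖u - z 0‖ ≤ ‖u‖ + (R + V) :=
      (norm_sub_le _ _).trans (add_le_add le_rfl (hznorm 0 (Nat.zero_le _)))
    linarith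
  have hvar0 : 0 ≤ ‖u - z 0‖ + ∑ k ∈ Finset.range j, ‖z k - z (k + 1)‖ := by positivity
  -- combine: `‖f u‖ ≤ C e^{(‖u‖ + L + s)^ρ} (L/s)^{j+1}`
  have hLne : L ≠ 0 := hLpos.ne'
  have hsne : s ≠ 0 := hspos.ne'
  have he2 : Real.exp 2 ≠ 0 := (Real.exp_pos 2).ne'
  have hLs : L / s = Real.exp (-2) := by
    rw [hs, Real.exp_neg]; field_simp
  have hstep1 : ‖f u‖ ≤ C * Real.exp ((‖u‖ + L + s) ^ ρ) * Real.exp (-2) ^ (j + 1) := by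
    calc ‖f u‖ ≤ (j + 1).factorial * (C * Real.exp ((‖u‖ + L + s) ^ ρ)) / s ^ (j + 1) *
          (‖u - z 0‖ + ∑ k ∈ Finset.range j, ‖z k - z (k + 1)‖) ^ (j + 1) /
            (j + 1).factorial := hG
      _ ≤ (j + 1).factorial * (C * Real.exp ((‖u‖ + L + s) ^ ρ)) / s ^ (j + 1) *
          L ^ (j + 1) / (j + 1).factorial := by
          gcongr
      _ = C * Real.exp ((‖u‖ + L + s) ^ ρ) * (L / s) ^ (j + 1) := by
          have hfact : ((j + 1).factorial : ℝ) ≠ 0 := by positivity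
          rw [div_pow]
          field_simp
      _ = C * Real.exp ((‖u‖ + L + s) ^ ρ) * Real.exp (-2) ^ (j + 1) := by rw [hLs]
  -- the exponent: `(‖u‖ + L + s)^ρ ≤ (j+1) + a² + K`
  have hE : ‖u‖ + L + s = a + b * Real.sqrt (j + 1 : ℕ) := by
    rw [hs, hL, ha, hb]; ring
  have hexp : (‖u‖ + L + s) ^ ρ ≤ ((j + 1 : ℕ) : ℝ) + a ^ 2 + K := by
    rw [hE]
    set N : ℝ := ((j + 1 : ℕ) : ℝ) with hN
    set q : ℝ := Real.sqrt N with hq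
    have hN0 : 0 ≤ N := Nat.cast_nonneg _
    have hq0 : 0 ≤ q := Real.sqrt_nonneg _
    have hx : 0 ≤ a + b * q := by positivity
    refine (hK _ hx).trans ?_
    have hsq : (a + b * q) ^ 2 ≤ 2 * a ^ 2 + 2 * b ^ 2 * N := by
      have e : q ^ 2 = N := Real.sq_sqrt hN0
      have h3 : (a + b * q) ^ 2 = 2 * a ^ 2 + 2 * b ^ 2 * q ^ 2 - (a - b * q) ^ 2 := by ring
      rw [h3, e]
      linarith [sq_nonneg (a - b * q)]
    have hden : 0 < 2 * b ^ 2 + 2 := by positivity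
    have h1 : 1 / (2 * b ^ 2 + 2) * (a + b * q) ^ 2 ≤ N + a ^ 2 := by
      calc 1 / (2 * b ^ 2 + 2) * (a + b * q) ^ 2
          ≤ 1 / (2 * b ^ 2 + 2) * (2 * a ^ 2 + 2 * b ^ 2 * N) :=
            mul_le_mul_of_nonneg_left hsq (by positivity)
        _ ≤ N + a ^ 2 := by
            rw [div_mul_eq_mul_div, one_mul, div_le_iff₀ hden]
            have h4 : (N + a ^ 2) * (2 * b ^ 2 + 2) =
                2 * a ^ 2 + 2 * b ^ 2 * N + (2 * N + 2 * a ^ 2 * b ^ 2) := by ring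
            rw [h4]
            have h5 : 0 ≤ 2 * N + 2 * a ^ 2 * b ^ 2 := by positivity
            linarith
    linarith
  -- conclude
  calc ‖f u‖ ≤ C * Real.exp ((‖u‖ + L + s) ^ ρ) * Real.exp (-2) ^ (j + 1) := hstep1
    _ ≤ C * Real.exp (((j + 1 : ℕ) : ℝ) + a ^ 2 + K) * Real.exp (-2) ^ (j + 1) := by
        gcongr
    _ = C * Real.exp (K + a ^ 2) * Real.exp (-((j + 1 : ℕ) : ℝ)) := by
        have key : Real.exp (((j + 1 : ℕ) : ℝ) + a ^ 2 + K) * Real.exp (-2) ^ (j + 1) =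
            Real.exp (K + a ^ 2) * Real.exp (-((j + 1 : ℕ) : ℝ)) := by
          rw [← Real.exp_nat_mul, ← Real.exp_add, ← Real.exp_add]
          congr 1
          push_cast
          ring
        rw [mul_assoc, key, ← mul_assoc]

/-- **Kim's theorem (Farmer 2022, §2; Kim 1996), discharged** for the tree's statement
`Farmer2022_kimTheorem`: if `f` is entire of order `< 2`, real on the real axis, with all zeros
in a horizontal strip, and no derivative of `f` vanishes identically, then for every `R > 0` and
all sufficiently large `n`, every zero of `f^{(n)}` in `|z| < R` is real. Proof: Ki–Kim 2000 §2
(Jensen chains + Gontcharoff's estimate + Cauchy's estimate), see the module docstring.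
[cite: Farmer2022, §2] [cite: Kim1996] [cite: KiKim2000, §2 Thm. 2.1 and Remark 2.2 (b)] -/
theorem Farmer2022_kimTheorem_holds : Farmer2022_kimTheorem := by
  intro f hf hnz R hR
  obtain ⟨hford, hreal, Δ₀, hstrip₀⟩ := hf
  have hdiff : Differentiable ℂ f := hford.1
  obtain ⟨ρ, C, hρ0, hρ, hgr⟩ := exists_growth_nonneg hford
  have hC : 0 ≤ C := growthConst_nonneg hgr
  set Δ : ℝ := max Δ₀ 0 with hΔdef
  have hΔ : 0 ≤ Δ := le_max_right _ _
  have hstrip : ∀ z, f z = 0 → |z.im| ≤ Δ := fun z hz ↦ (hstrip₀ z hz).trans (le_max_left _ _)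
  have hstripk : ∀ (k : ℕ) (z : ℂ), iteratedDeriv k f z = 0 → |z.im| ≤ Δ := fun k z hz ↦
    abs_im_le_of_iteratedDeriv_eq_zero hdiff hρ0 hρ hgr hreal hnz hΔ hstrip k hz
  by_contra hcon
  push Not at hcon
  -- non-real zeros in `|z| < R` for arbitrarily large `n`, w.l.o.g. in the upper half-plane
  have hbad : ∀ N : ℕ, ∃ n, N ≤ n ∧ ∃ w : ℂ, ‖w‖ < R ∧ iteratedDeriv n f w = 0 ∧ 0 < w.im := by
    intro N
    obtain ⟨n, hn, z, hzR, hz0, hzim⟩ := hcon N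
    rcases lt_or_gt_of_ne hzim with hneg | hpos
    · refine ⟨n, hn, conj z, by rwa [Complex.norm_conj], ?_, by simpa using hneg⟩
      rw [apply_conj_eq_conj (differentiable_iteratedDeriv_of_entire hdiff n)
        (im_iteratedDeriv_ofReal hdiff hreal n), hz0, map_zero]
    · exact ⟨n, hn, z, hzR, hz0, hpos⟩
  -- hence `f ≡ 0`
  suffices hmain : ∀ u : ℂ, f u = 0 by
    exact hnz 0 (funext fun u ↦ by simpa using hmain u)
  intro u
  obtain ⟨K, hK⟩ := norm_le_exp_neg_of_nonreal_zero hdiff hρ0 hρ hgr hreal hnz hΔ hstripk u hR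
  have hle : ∀ N : ℕ, ‖f u‖ ≤ C * Real.exp K * Real.exp (-(N : ℝ)) := by
    intro N
    obtain ⟨n, hn, hw⟩ := hbad (max N 1)
    have h1 : 1 ≤ n := (le_max_right _ _).trans hn
    have hNn : (N : ℝ) ≤ n := by exact_mod_cast (le_max_left _ _).trans hn
    calc ‖f u‖ ≤ C * Real.exp K * Real.exp (-(n : ℝ)) := hK n h1 hw
      _ ≤ C * Real.exp K * Real.exp (-(N : ℝ)) := by gcongr
  have hlim : Tendsto (fun N : ℕ ↦ C * Real.exp K * Real.exp (-(N : ℝ))) atTop (𝓝 0) := by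
    have h := (Real.tendsto_exp_neg_atTop_nhds_zero.comp tendsto_natCast_atTop_atTop).const_mul
      (C * Real.exp K)
    simpa using h
  have h0 : ‖f u‖ ≤ 0 := ge_of_tendsto' hlim hle
  exact norm_le_zero_iff.1 h0

end Literature.Barriers.RiemannHypothesis
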